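import Mathlib
import Summits.NavierStokesRegularity.NavierStokesRegularity.Theorems.EulerZoomLiouvillePowerGaugeEulerLiouvilleSelfSimilarOwnRateSubExtremalPast
import Summits.NavierStokesRegularity.NavierStokesRegularity.Theorems.EulerZoomLiouvillePowerGaugeEulerLiouvilleEnergySaturationOwnRateLaw
import HarnessLib

/-!
# THE OWN-RATE DICHOTOMY for the residual power clocks `g ∈ [2/5, ½]` (census form, one statement): a past/shifted collapse of rate `g` in Seregin's
# class EITHER vanishes OR its own-rate normalised profile energy converges to a POSITIVE limit
# (crux `EulerZoomLiouville.PowerGaugeEulerLiouville` = stmt-NavierStokesRegularity-19832; line `logtime-breathers`, residue T4 `stub_powerClockRest`)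

Route `EulerZoomLiouville` (NavierStokesRegularity); width seat ns-ezl-w6 (cell ns-regularity-ideate, LEAD ns-typeII-p2).  Assembly of
`…SelfSimilarOwnRateSubExtremalPast` (own-rate sub-extremal ⇒ trivial) and `…EnergySaturationOwnRateLaw` (the own-rate normalised energy converges):

* `SlowClock.ownRate_dichotomy_past` — crux hypotheses verbatim + the rate-`g` representation about `(T, x₀)` for `τ < T₁` (`2/5 ≤ g`, `2g ≤ 1`) + a cut-off `σ`
  ⇒ `u = 0` a.e. on the slab, OR `L^{2/g−5}∫σ(L⁻¹y)|W|² → N_∞` with `N_∞ > 0` (so `∫_{B_L}|W|² ∼ L^{5−2/g}`: the clock is OWN-RATE EXTREMAL — a class-rate twin of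
  the fictitious class `ρ' = 1/g − 2`).

WHAT THIS IS NOT: not NS, not E — the census statement of one residue of the crux CLASS 19832 on the MODEL lattice (`--supports` stmt-19832); the second
alternative is NOT excluded here; 19832 OPEN. [folklore; cf. BronziShvydkoy2015 Thm 1.1, Rem 1.4]
-/

noncomputable section

-- flat `Theorems/<Route><Decl>…` files of one crux share the namespace of the crux (tree convention: `Summit.<S>.<S>.…`)
set_option linter.dupNamespace false

open MeasureTheory Set Filter Topology Metric Function TopologicalSpace
open scoped ENNReal NNReal RealInnerProductSpace

namespace Summit.NavierStokesRegularity.NavierStokesRegularity.Theorems.PowerGaugeEulerLiouville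

open Literature.Analysis Literature.Analysis.FunctionSpaces Literature.Analysis.FluidPDE

namespace SlowClock

variable {ρ g T T₁ : ℝ} {x₀ : EuclideanSpace ℝ (Fin 3)} {σ : EuclideanSpace ℝ (Fin 3) → ℝ}
  {u : ℝ → EuclideanSpace ℝ (Fin 3) → EuclideanSpace ℝ (Fin 3)} {p : ℝ → EuclideanSpace ℝ (Fin 3) → ℝ}
  {H : ℝ → EuclideanSpace ℝ (Fin 3) → EuclideanSpace ℝ (Fin 3) →L[ℝ] EuclideanSpace ℝ (Fin 3)} {c : ℝ≥0}
  {W : EuclideanSpace ℝ (Fin 3) → EuclideanSpace ℝ (Fin 3)} {P : EuclideanSpace ℝ (Fin 3) → ℝ}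

/-- **THE OWN-RATE DICHOTOMY (member level).**  Crux hypotheses verbatim (`0 < ρ ≤ ½`, weak class) + exact self-similarity of `(u, p)` about `(T, x₀)` at a
rate `g` with `2/5 ≤ g`, `2g ≤ 1` FOR `τ < T₁` ONLY (`T₁ ≤ 0`, `T₁ ≤ T`) + a cut-off `σ` (`0 ≤ σ ≤ 1`, `σ = 1` on `B̄₁`, `σ = 0` off `B₂`): EITHER `u = 0` a.e. on
`(−∞,0) × ℝ³`, OR the own-rate normalised profile energy `L^{2/g−5}∫σ(L⁻¹y)|W|²` tends to a limit `N_∞ > 0`. [folklore; cf. BronziShvydkoy2015 Thm 1.1] -/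
theorem ownRate_dichotomy_past (hρ : 0 < ρ) (hρh : ρ ≤ 1 / 2) (hT₁ : T₁ ≤ 0) (hTT₁ : T₁ ≤ T)
    (x₀ : EuclideanSpace ℝ (Fin 3))
    (hsw : IsSuitableWeakSolutionOn (slab (EuclideanSpace ℝ (Fin 3)) (Iio 0) isOpen_Iio) 0 0 u p)
    (hH : HasWeakSpatialGradientOn (slab (EuclideanSpace ℝ (Fin 3)) (Iio 0) isOpen_Iio) u H)
    (hgauge : ∀ a : ℝ, 0 < a →
      ENNReal.ofReal (a ^ (2 * ρ)) * cknA a (0 : ℝ × EuclideanSpace ℝ (Fin 3)) u +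
          ENNReal.ofReal (a ^ ρ) * cknE a (0 : ℝ × EuclideanSpace ℝ (Fin 3)) H +
        ENNReal.ofReal (a ^ (2 * ρ)) * cknD a (0 : ℝ × EuclideanSpace ℝ (Fin 3)) p ≤ (c : ℝ≥0∞))
    (hg25 : 2 / 5 ≤ g) (hg2 : 2 * g ≤ 1)
    (hu : ∀ τ : ℝ, τ < T₁ → u τ = fun x => selfSimilarCollapse g T W τ (x - x₀))
    (hp : ∀ τ : ℝ, τ < T₁ → p τ = fun x => selfSimilarCollapsePressure g T P τ (x - x₀))
    (hσ : IsTestFunctionOn (⊤ : Opens (EuclideanSpace ℝ (Fin 3))) σ) (h0 : ∀ z, 0 ≤ σ z)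
    (h1 : ∀ z, σ z ≤ 1) (hone : ∀ z, ‖z‖ ≤ 1 → σ z = 1) (hzero : ∀ z, 2 ≤ ‖z‖ → σ z = 0) :
    uncurry u =ᵐ[volume.restrict (Iio (0 : ℝ) ×ˢ (univ : Set (EuclideanSpace ℝ (Fin 3))))] 0 ∨
      ∃ Ninf : ℝ, 0 < Ninf ∧
        Tendsto (fun L : ℝ => L ^ (2 / g - 5) * ∫ y, σ (L⁻¹ • y) * ‖W y‖ ^ 2) atTop (𝓝 Ninf) := by
  have hg0 : 0 < g := by linarith
  obtain ⟨Ninf, hlim⟩ := tendsto_ownRate_normEnergy_past hρ hρh hT₁ hTT₁ x₀ hsw hH hgauge hg25 hg2 hu hp hσ h0 h1 hone hzero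
  by_cases hpos : 0 < Ninf
  · exact Or.inr ⟨Ninf, hpos, hlim⟩
  · -- `N_∞ ≤ 0`: the member is own-rate sub-extremal, hence trivial
    left
    push Not at hpos
    refine selfSimilar_ae_eq_zero_of_ownRate_subExtremal_past hρ hρh hT₁ hTT₁ x₀ hsw hH hgauge hg0 hg2 hu hp ?_
    intro ε hε L₀
    -- the profile data: measurability and local integrability of `|W|²` (for the comparison `∫_{B_L} ≤ ∫ σ_L`)
    obtain ⟨G, c', hWm, -, -, -, hA₁, -⟩ :=
      exists_locData_past_rate hρ hρh hT₁ hTT₁ x₀ hsw hH hgauge hg0.le hg2 hu hp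
    have hev : ∀ᶠ L in atTop, L ^ (2 / g - 5) * ∫ y, σ (L⁻¹ • y) * ‖W y‖ ^ 2 < ε :=
      hlim.eventually (gt_mem_nhds (lt_of_le_of_lt hpos hε))
    obtain ⟨L, hLlt, hLge⟩ := (hev.and (eventually_ge_atTop (max L₀ 1))).exists
    have hL1 : 1 ≤ L := (le_max_right _ _).trans hLge
    have hL0 : 0 < L := lt_of_lt_of_le one_pos hL1
    refine ⟨L, (le_max_left _ _).trans hLge, lt_of_le_of_lt ?_ hLlt⟩
    -- `∫_{B_L}|W|² ≤ ∫ σ(L⁻¹y)|W|²` (`σ(L⁻¹y) = 1` on `B_L`, `σ ≥ 0`)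
    refine mul_le_mul_of_nonneg_left ?_ (Real.rpow_nonneg hL0.le _)
    have hB : IntegrableOn (fun y => ‖W y‖ ^ 2) (ball (0 : EuclideanSpace ℝ (Fin 3)) L) volume :=
      (memLp_two_iff_integrable_sq_norm hWm.restrict).1 (EnergySaturation.memLp_two_ball_of_growth_loc hWm hA₁ _)
    have hV2 : LocallyIntegrable (fun y => ‖W y‖ ^ 2) volume :=
      EnergySaturation.locallyIntegrable_norm_sq_of_growth_loc hWm hA₁
    have hint : Integrable (fun y => σ (L⁻¹ • y) * ‖W y‖ ^ 2) volume := by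
      have hcont : Continuous (fun y : EuclideanSpace ℝ (Fin 3) => σ (L⁻¹ • y)) :=
        hσ.contDiff.continuous.comp (continuous_const_smul _)
      have := hV2.integrable_smul_left_of_hasCompactSupport hcont (hσ.hasCompactSupport.comp_smul (inv_ne_zero hL0.ne'))
      simpa only [smul_eq_mul] using this
    rw [← integral_indicator measurableSet_ball]
    refine integral_mono_of_nonneg (Eventually.of_forall fun y => ?_) hint (Eventually.of_forall fun y => ?_)
    · show 0 ≤ (ball (0 : EuclideanSpace ℝ (Fin 3)) L).indicator (fun y => ‖W y‖ ^ 2) y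
      exact indicator_nonneg (fun _ _ => sq_nonneg _) _
    · show (ball (0 : EuclideanSpace ℝ (Fin 3)) L).indicator (fun y => ‖W y‖ ^ 2) y ≤ σ (L⁻¹ • y) * ‖W y‖ ^ 2
      by_cases hy : y ∈ ball (0 : EuclideanSpace ℝ (Fin 3)) L
      · rw [indicator_of_mem hy]
        have hσ1 : σ (L⁻¹ • y) = 1 := by
          apply hone
          rw [mem_ball, dist_zero_right] at hy
          rw [norm_smul, norm_inv, Real.norm_of_nonneg hL0.le, inv_mul_le_iff₀ hL0]
          linarith
        rw [hσ1, one_mul]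
      · rw [indicator_of_notMem hy]
        exact mul_nonneg (h0 _) (sq_nonneg _)

end SlowClock

end Summit.NavierStokesRegularity.NavierStokesRegularity.Theorems.PowerGaugeEulerLiouville

end
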